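import Literature.MathematicalPhysics.QuantumLattice.TrilayerSplittingIdentities
import Literature.MathematicalPhysics.QuantumLattice.BilayerTwoOrbitalBloch

/-!
# The trilayer even sector OFF degeneracy: closed-form bonding/antibonding levels and the exact
# inner-plane weights as functions of the inner–outer level offset

`TrilayerSplittingIdentities.lean` proves that the mirror-symmetric scalar trilayer
`!![εo, s, t; s, εo, t; t, t, εi]` (outer level `εo`, inner level `εi`, outer–inner hopping `t`,
outer–outer hopping `s`) splits EXACTLY into the non-bonding state `(1, −1, 0)` at `εo − s` (inner
weight `0`) and the even `2 × 2` problem `[[εo + s, t], [2t, εi]]` on `(a, a, b)`, solving the latter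
only in the degenerate case `εi = εo + s` (levels `εi ± √2·t`, inner weight `½` each) and stating
«off degeneracy … nothing further is asserted».  The trilayer nickelate La₄Ni₃O₁₀ is OFF degeneracy:
every printed two-orbital Wannier set puts the inner-plane `d_{3z²−r²}` level ABOVE the outer one —
by `0.416 eV` in [SakakibaraEtAl2024, Table I caption] («the onsite energy offset between the inner-
and outer-layer … d_{3z²−r²} orbitals is … 0.416 eV»), `0.383–0.42 eV` across the five HP sets hulled
in the cell's REFVALS-1 §O11 — at an inter-layer hopping `|t⊥| ≈ 0.7 eV` of the same order.  This
file closes that gap with the elementary algebra every consumer of those two numbers needs: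

* §1 With `δ := εi − (εo + s)` (inner minus even-outer level) and `D := √(δ² + 8t²)`, the even
  eigenvectors are `(1, 1, α_±)` with `α_± = (δ ± D)/(2t)` (`t ≠ 0`), the roots of
  `t α² − δ α − 2t = 0` (`evenRoot_quadratic`), and the levels are
  `λ_± = (εo + s + εi)/2 ± D/2` (`trilayerScalar_mulVec_evenVec`, `evenLevel_closed`) — the symmetric
  two-level closed form of `BilayerTwoOrbitalBloch` §3 on `[[εo + s, √2 t], [√2 t, εi]]`
  (`evenLevel_eq_lvl`).  Vieta: `α_+ α_− = −2`, `α_+ + α_− = δ/t`.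
* §2 Splitting `λ_+ − λ_− = D = √(δ² + 8t²) ≥ 2√2·|t|`, with equality iff `δ = 0` — the degenerate
  `±√2 t` of the parent file is the MINIMUM bonding–antibonding splitting; a level offset only widens
  it (`evenSplitting_*`).
* §3 INNER-PLANE WEIGHTS.  The state `(1, 1, α)` has inner weight `w(α) = α²/(2 + α²)`; on the two
  even states `w_± = ½(1 ± δ/D)` EXACTLY (`innerWeight_plus`, `innerWeight_minus`), they sum to `1`
  (`innerWeight_sum`: with the non-bonding `0` the inner plane is fully accounted for), each lies in
  `[0, 1]`, and `δ > 0` (inner level higher — the printed sign) puts MORE than half of the inner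
  weight in the UPPER even state and less than half in the lower one (`innerWeight_plus_gt_half`);
  `δ = 0` returns `½, ½` (`innerWeight_of_degenerate`).
* §4 A rational instance (`εo = s = 0`, `εi = 1`, `t = 1`: `D = 3`, levels `2` and `−1`, eigenvectors
  `(1,1,2)` and `(1,1,−1)`, inner weights `2/3` and `1/3`) checked by `norm_num`.

Everything is PROVED; no named facts, no axioms beyond Mathlib's, no `sorry`.  NOT here: which sign of
`t⊥` a code prints, `k`-dependence, the inequivalent-outer-plane case, any material NUMBER (the offsets
and hoppings above are quoted in the docstring only as the reason the off-degenerate case matters).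

References: H. Sakakibara et al., Phys. Rev. B 109 (2024) 144511, arXiv:2309.09462, §III, Table I and
its caption (inner/outer `ΔE` and on-site offsets of La₄Ni₃O₁₀; the non-bonding band's «less than 5 %»
inner component); Z. Luo et al., Phys. Rev. Lett. 131 (2023) 126001, Eq. (3) (the two-level closed
form, as typed in `BilayerTwoOrbitalBloch`).  AI-produced formalisation (H21, cell hubbard-downfold,
seat lit-1, 2026-08-27).
-/

noncomputable section

namespace Literature.MathematicalPhysics.QuantumLattice

namespace TrilayerEven

open Real Matrix

/-! ## §1 The even eigenvectors `(1, 1, α_±)` and their levels in closed form -/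

/-- Inner-minus-even-outer level offset `δ = εi − (εo + s)`. [cite: SakakibaraEtAl2024, Table I caption] -/
def offset (εo εi s : ℝ) : ℝ := εi - (εo + s)

/-- Unfolding. [cite: SakakibaraEtAl2024, Table I caption] -/
theorem offset_def (εo εi s : ℝ) : offset εo εi s = εi - (εo + s) := rfl

/-- The even-sector discriminant root `D = √(δ² + 8t²)`. [cite: LuoEtAl2023, Eq. (3)] -/
def disc (δ t : ℝ) : ℝ := sqrt (δ ^ 2 + 8 * t ^ 2)

/-- Unfolding. [cite: LuoEtAl2023, Eq. (3)] -/
theorem disc_def (δ t : ℝ) : disc δ t = sqrt (δ ^ 2 + 8 * t ^ 2) := rfl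

/-- `D² = δ² + 8t²`. [cite: LuoEtAl2023, Eq. (3)] -/
theorem disc_sq (δ t : ℝ) : disc δ t ^ 2 = δ ^ 2 + 8 * t ^ 2 := by
  rw [disc_def, sq_sqrt (by positivity)]

/-- `D ≥ 0`. [cite: LuoEtAl2023, Eq. (3)] -/
theorem disc_nonneg (δ t : ℝ) : 0 ≤ disc δ t := sqrt_nonneg _

/-- `|δ| ≤ D`. [cite: LuoEtAl2023, Eq. (3)] -/
theorem abs_le_disc (δ t : ℝ) : |δ| ≤ disc δ t := by
  rw [disc_def, ← sqrt_sq_eq_abs]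
  exact sqrt_le_sqrt (by nlinarith [sq_nonneg t])

/-- `D > 0` as soon as `t ≠ 0`. [cite: LuoEtAl2023, Eq. (3)] -/
theorem disc_pos {δ t : ℝ} (ht : t ≠ 0) : 0 < disc δ t := by
  rw [disc_def]
  apply sqrt_pos.mpr
  have : 0 < t ^ 2 := by positivity
  nlinarith [sq_nonneg δ]

/-- `|δ| < D` when `t ≠ 0` (so `δ/D ∈ (−1, 1)`). [cite: LuoEtAl2023, Eq. (3)] -/
theorem abs_lt_disc {δ t : ℝ} (ht : t ≠ 0) : |δ| < disc δ t := by
  have hD := disc_pos (δ := δ) ht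
  have h2 : δ ^ 2 < disc δ t ^ 2 := by
    rw [disc_sq]; have : 0 < t ^ 2 := by positivity
    linarith
  rw [← sq_abs] at h2
  exact lt_of_pow_lt_pow_left₀ 2 hD.le h2

/-- Inner amplitude of the upper even state: `α_+ = (δ + D)/(2t)`. [cite: LuoEtAl2023, Eq. (3)] -/
def alphaP (δ t : ℝ) : ℝ := (δ + disc δ t) / (2 * t)

/-- Inner amplitude of the lower even state: `α_− = (δ − D)/(2t)`. [cite: LuoEtAl2023, Eq. (3)] -/
def alphaM (δ t : ℝ) : ℝ := (δ - disc δ t) / (2 * t)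

/-- Unfolding. [cite: LuoEtAl2023, Eq. (3)] -/
theorem alphaP_def (δ t : ℝ) : alphaP δ t = (δ + disc δ t) / (2 * t) := rfl

/-- Unfolding. [cite: LuoEtAl2023, Eq. (3)] -/
theorem alphaM_def (δ t : ℝ) : alphaM δ t = (δ - disc δ t) / (2 * t) := rfl

/-- Vieta, product: `α_+ · α_− = −2`. [cite: LuoEtAl2023, Eq. (3)] -/
theorem alphaP_mul_alphaM {δ t : ℝ} (ht : t ≠ 0) : alphaP δ t * alphaM δ t = -2 := by
  rw [alphaP_def, alphaM_def]
  have hD := disc_sq δ t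
  field_simp
  nlinarith [hD]

/-- Vieta, sum: `α_+ + α_− = δ/t`. [cite: LuoEtAl2023, Eq. (3)] -/
theorem alphaP_add_alphaM {δ t : ℝ} (ht : t ≠ 0) : alphaP δ t + alphaM δ t = δ / t := by
  rw [alphaP_def, alphaM_def]
  field_simp
  ring

/-- The even eigen-condition: `(1, 1, α)` is an eigenvector of the scalar trilayer iff
`t α² − δ α − 2t = 0`, and then the eigenvalue is `εo + s + t α` — from `trilayerScalar_mulVec_even`.
[cite: SakakibaraEtAl2024, §III] -/
theorem trilayerScalar_mulVec_evenVec (εo εi t s α : ℝ)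
    (hα : t * α ^ 2 - offset εo εi s * α - 2 * t = 0) :
    trilayerScalar εo εi t s *ᵥ ![1, 1, α] = (εo + s + t * α) • ![1, 1, α] := by
  rw [trilayerScalar_mulVec_even]
  rw [offset_def] at hα
  ext i
  fin_cases i
  · simp
  · simp
  · simp
    linear_combination (-1 : ℝ) * hα

/-- `α_+` solves the even quadratic. [cite: LuoEtAl2023, Eq. (3)] -/
theorem evenRoot_quadratic_plus {δ t : ℝ} (ht : t ≠ 0) :
    t * alphaP δ t ^ 2 - δ * alphaP δ t - 2 * t = 0 := by
  rw [alphaP_def]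
  have hD := disc_sq δ t
  field_simp
  nlinarith [hD]

/-- `α_−` solves the even quadratic. [cite: LuoEtAl2023, Eq. (3)] -/
theorem evenRoot_quadratic_minus {δ t : ℝ} (ht : t ≠ 0) :
    t * alphaM δ t ^ 2 - δ * alphaM δ t - 2 * t = 0 := by
  rw [alphaM_def]
  have hD := disc_sq δ t
  field_simp
  nlinarith [hD]

/-- Upper even level `λ_+ = (εo + s + εi)/2 + D/2`. [cite: LuoEtAl2023, Eq. (3)] -/
def levelP (εo εi t s : ℝ) : ℝ := (εo + s + εi) / 2 + disc (offset εo εi s) t / 2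

/-- Lower even level `λ_− = (εo + s + εi)/2 − D/2`. [cite: LuoEtAl2023, Eq. (3)] -/
def levelM (εo εi t s : ℝ) : ℝ := (εo + s + εi) / 2 - disc (offset εo εi s) t / 2

/-- Unfolding. [cite: LuoEtAl2023, Eq. (3)] -/
theorem levelP_def (εo εi t s : ℝ) :
    levelP εo εi t s = (εo + s + εi) / 2 + disc (offset εo εi s) t / 2 := rfl

/-- Unfolding. [cite: LuoEtAl2023, Eq. (3)] -/
theorem levelM_def (εo εi t s : ℝ) :
    levelM εo εi t s = (εo + s + εi) / 2 - disc (offset εo εi s) t / 2 := rfl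

/-- The eigenvalue `εo + s + t α_+` IS the closed form `λ_+`. [cite: LuoEtAl2023, Eq. (3)] -/
theorem evenLevel_closed_plus {εo εi t s : ℝ} (ht : t ≠ 0) :
    εo + s + t * alphaP (offset εo εi s) t = levelP εo εi t s := by
  rw [alphaP_def, levelP_def, offset_def]
  field_simp
  ring

/-- The eigenvalue `εo + s + t α_−` IS the closed form `λ_−`. [cite: LuoEtAl2023, Eq. (3)] -/
theorem evenLevel_closed_minus {εo εi t s : ℝ} (ht : t ≠ 0) :
    εo + s + t * alphaM (offset εo εi s) t = levelM εo εi t s := by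
  rw [alphaM_def, levelM_def, offset_def]
  field_simp
  ring

/-- **Upper even state**: `(1, 1, α_+)` is an eigenvector with eigenvalue `λ_+`.
[cite: SakakibaraEtAl2024, §III] [cite: LuoEtAl2023, Eq. (3)] -/
theorem trilayerScalar_mulVec_evenPlus {εo εi t s : ℝ} (ht : t ≠ 0) :
    trilayerScalar εo εi t s *ᵥ ![1, 1, alphaP (offset εo εi s) t]
      = levelP εo εi t s • ![1, 1, alphaP (offset εo εi s) t] := by
  rw [← evenLevel_closed_plus ht]
  exact trilayerScalar_mulVec_evenVec εo εi t s _ (evenRoot_quadratic_plus ht)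

/-- **Lower even state**: `(1, 1, α_−)` is an eigenvector with eigenvalue `λ_−`.
[cite: SakakibaraEtAl2024, §III] [cite: LuoEtAl2023, Eq. (3)] -/
theorem trilayerScalar_mulVec_evenMinus {εo εi t s : ℝ} (ht : t ≠ 0) :
    trilayerScalar εo εi t s *ᵥ ![1, 1, alphaM (offset εo εi s) t]
      = levelM εo εi t s • ![1, 1, alphaM (offset εo εi s) t] := by
  rw [← evenLevel_closed_minus ht]
  exact trilayerScalar_mulVec_evenVec εo εi t s _ (evenRoot_quadratic_minus ht)

/-- The even levels are the symmetric two-level closed form of `BilayerTwoOrbitalBloch` §3 applied to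
`[[εo + s, √2·t], [√2·t, εi]]` (the even block in the NORMALISED even basis).
[cite: LuoEtAl2023, Eq. (3)] -/
theorem evenLevel_eq_lvl (εo εi t s : ℝ) :
    levelP εo εi t s = BilayerTwoOrbital.lvlP (εo + s) εi (sqrt 2 * t) ∧
      levelM εo εi t s = BilayerTwoOrbital.lvlM (εo + s) εi (sqrt 2 * t) := by
  have h2 : sqrt 2 ^ 2 = 2 := sq_sqrt (by norm_num)
  have hrad : ((εo + s - εi) / 2) ^ 2 + (sqrt 2 * t) ^ 2 = (offset εo εi s ^ 2 + 8 * t ^ 2) / 4 := by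
    rw [mul_pow, h2, offset_def]; ring
  have hsq : sqrt (((εo + s - εi) / 2) ^ 2 + (sqrt 2 * t) ^ 2) = disc (offset εo εi s) t / 2 := by
    rw [hrad, disc_def, sqrt_div (by positivity), show (4:ℝ) = 2 ^ 2 by norm_num, sqrt_sq (by norm_num)]
  constructor
  · rw [levelP_def, BilayerTwoOrbital.lvlP, hsq]
  · rw [levelM_def, BilayerTwoOrbital.lvlM, hsq]

/-- Trace of the even block: `λ_+ + λ_− = εo + s + εi`. [cite: LuoEtAl2023, Eq. (3)] -/
theorem levelP_add_levelM (εo εi t s : ℝ) : levelP εo εi t s + levelM εo εi t s = εo + s + εi := by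
  rw [levelP_def, levelM_def]; ring

/-! ## §2 The bonding–antibonding splitting `D = √(δ² + 8t²) ≥ 2√2|t|` -/

/-- `λ_+ − λ_− = D`. [cite: LuoEtAl2023, Eq. (3)] -/
theorem evenSplitting (εo εi t s : ℝ) :
    levelP εo εi t s - levelM εo εi t s = disc (offset εo εi s) t := by
  rw [levelP_def, levelM_def]; ring

/-- `D ≥ 2√2·|t|`: the degenerate `±√2 t` of `TrilayerSplittingIdentities` is the MINIMUM splitting;
an inner/outer level offset only widens it. [cite: SakakibaraEtAl2024, Table I caption] [cite: LuoEtAl2023, Eq. (3)] -/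
theorem evenSplitting_ge (δ t : ℝ) : 2 * sqrt 2 * |t| ≤ disc δ t := by
  have h : 2 * sqrt 2 * |t| = sqrt (8 * t ^ 2) := by
    rw [show (8:ℝ) * t ^ 2 = (2 * sqrt 2 * |t|) ^ 2 by
      rw [mul_pow, mul_pow, sq_abs, sq_sqrt (by norm_num : (0:ℝ) ≤ 2)]; ring]
    rw [sqrt_sq (by positivity)]
  rw [h, disc_def]
  exact sqrt_le_sqrt (by nlinarith [sq_nonneg δ])

/-- At zero offset the splitting is exactly `2√2·|t|`. [cite: SakakibaraEtAl2024, §III] -/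
theorem evenSplitting_of_degenerate (t : ℝ) : disc 0 t = 2 * sqrt 2 * |t| := by
  rw [disc_def]
  rw [show (0:ℝ) ^ 2 + 8 * t ^ 2 = (2 * sqrt 2 * |t|) ^ 2 by
    rw [mul_pow, mul_pow, sq_abs, sq_sqrt (by norm_num : (0:ℝ) ≤ 2)]; ring]
  exact sqrt_sq (by positivity)

/-- Conversely the splitting exceeds `2√2·|t|` STRICTLY as soon as `δ ≠ 0`.
[cite: SakakibaraEtAl2024, Table I caption] -/
theorem evenSplitting_gt_of_offset_ne {δ : ℝ} (hδ : δ ≠ 0) (t : ℝ) : 2 * sqrt 2 * |t| < disc δ t := by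
  rw [← evenSplitting_of_degenerate, disc_def, disc_def]
  apply sqrt_lt_sqrt (by positivity)
  have : 0 < δ ^ 2 := by positivity
  linarith

/-! ## §3 Inner-plane weights `w_± = ½(1 ± δ/D)` -/

/-- Inner-plane weight of the (unnormalised) even state `(1, 1, α)`: `α²/(2 + α²)`.
[cite: SakakibaraEtAl2024, Fig. 2 caption] -/
def innerWeight (α : ℝ) : ℝ := α ^ 2 / (2 + α ^ 2)

/-- Unfolding. [cite: SakakibaraEtAl2024, Fig. 2 caption] -/
theorem innerWeight_def (α : ℝ) : innerWeight α = α ^ 2 / (2 + α ^ 2) := rfl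

/-- It is the squared inner amplitude over the squared norm of `![1, 1, α]`.
[cite: SakakibaraEtAl2024, Fig. 2 caption] -/
theorem innerWeight_eq_ratio (α : ℝ) :
    innerWeight α = ((![1, 1, α] : Fin 3 → ℝ) 2) ^ 2 /
      (((![1, 1, α] : Fin 3 → ℝ) 0) ^ 2 + ((![1, 1, α] : Fin 3 → ℝ) 1) ^ 2
        + ((![1, 1, α] : Fin 3 → ℝ) 2) ^ 2) := by
  simp [innerWeight_def]
  ring

/-- `0 ≤ w ≤ 1`, indeed `w < 1`. [cite: SakakibaraEtAl2024, Fig. 2 caption] -/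
theorem innerWeight_mem (α : ℝ) : 0 ≤ innerWeight α ∧ innerWeight α < 1 := by
  rw [innerWeight_def]
  have h : 0 < 2 + α ^ 2 := by positivity
  refine ⟨by positivity, ?_⟩
  rw [div_lt_one h]; linarith

/-- **Upper even state inner weight**: `w(α_+) = ½(1 + δ/D)`. [cite: SakakibaraEtAl2024, Table I caption]
[cite: LuoEtAl2023, Eq. (3)] -/
theorem innerWeight_plus {δ t : ℝ} (ht : t ≠ 0) :
    innerWeight (alphaP δ t) = (1 + δ / disc δ t) / 2 := by
  have hD := disc_pos (δ := δ) ht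
  have hD2 := disc_sq δ t
  rw [innerWeight_def, alphaP_def]
  have hden : (2:ℝ) + ((δ + disc δ t) / (2 * t)) ^ 2 ≠ 0 := by positivity
  rw [div_eq_div_iff hden (by norm_num : (2:ℝ) ≠ 0)]
  field_simp
  nlinarith [hD2, hD]

/-- **Lower even state inner weight**: `w(α_−) = ½(1 − δ/D)`. [cite: SakakibaraEtAl2024, Table I caption]
[cite: LuoEtAl2023, Eq. (3)] -/
theorem innerWeight_minus {δ t : ℝ} (ht : t ≠ 0) :
    innerWeight (alphaM δ t) = (1 - δ / disc δ t) / 2 := by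
  have hD := disc_pos (δ := δ) ht
  have hD2 := disc_sq δ t
  rw [innerWeight_def, alphaM_def]
  have hden : (2:ℝ) + ((δ - disc δ t) / (2 * t)) ^ 2 ≠ 0 := by positivity
  rw [div_eq_div_iff hden (by norm_num : (2:ℝ) ≠ 0)]
  field_simp
  nlinarith [hD2, hD]

/-- The two even inner weights sum to `1`: with the non-bonding `0`
(`trilayerScalar_nonbonding_innerWeight`) the single inner plane is fully accounted for.
[cite: SakakibaraEtAl2024, Fig. 2 caption] -/
theorem innerWeight_sum {δ t : ℝ} (ht : t ≠ 0) :
    innerWeight (alphaP δ t) + innerWeight (alphaM δ t) = 1 := by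
  rw [innerWeight_plus ht, innerWeight_minus ht]; ring

/-- The DIFFERENCE of the two inner weights is exactly `δ/D`. [cite: SakakibaraEtAl2024, Table I caption] -/
theorem innerWeight_plus_sub_minus {δ t : ℝ} (ht : t ≠ 0) :
    innerWeight (alphaP δ t) - innerWeight (alphaM δ t) = δ / disc δ t := by
  rw [innerWeight_plus ht, innerWeight_minus ht]; ring

/-- Inner level ABOVE the even outer level (`δ > 0`, the sign printed for La₄Ni₃O₁₀) puts MORE than half
of the inner weight in the upper even state and LESS than half in the lower one.
[cite: SakakibaraEtAl2024, Table I caption] -/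
theorem innerWeight_plus_gt_half {δ t : ℝ} (ht : t ≠ 0) (hδ : 0 < δ) :
    1 / 2 < innerWeight (alphaP δ t) ∧ innerWeight (alphaM δ t) < 1 / 2 := by
  have hD := disc_pos (δ := δ) ht
  have hq : 0 < δ / disc δ t := div_pos hδ hD
  rw [innerWeight_plus ht, innerWeight_minus ht]
  constructor <;> linarith

/-- … and symmetrically for `δ < 0`. [cite: SakakibaraEtAl2024, Table I caption] -/
theorem innerWeight_plus_lt_half {δ t : ℝ} (ht : t ≠ 0) (hδ : δ < 0) :
    innerWeight (alphaP δ t) < 1 / 2 ∧ 1 / 2 < innerWeight (alphaM δ t) := by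
  have hD := disc_pos (δ := δ) ht
  have hq : δ / disc δ t < 0 := div_neg_of_neg_of_pos hδ hD
  rw [innerWeight_plus ht, innerWeight_minus ht]
  constructor <;> linarith

/-- Zero offset returns the parent file's `½, ½`. [cite: SakakibaraEtAl2024, §III] -/
theorem innerWeight_of_degenerate {t : ℝ} (ht : t ≠ 0) :
    innerWeight (alphaP 0 t) = 1 / 2 ∧ innerWeight (alphaM 0 t) = 1 / 2 := by
  rw [innerWeight_plus ht, innerWeight_minus ht]
  constructor <;> simp

/-- The weight asymmetry is bounded by the offset-to-splitting ratio: `|w_+ − w_−| = |δ|/D < 1`.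
[cite: SakakibaraEtAl2024, Table I caption] -/
theorem abs_innerWeight_diff_lt_one {δ t : ℝ} (ht : t ≠ 0) :
    |innerWeight (alphaP δ t) - innerWeight (alphaM δ t)| < 1 := by
  rw [innerWeight_plus_sub_minus ht, abs_div, abs_of_pos (disc_pos ht), div_lt_one (disc_pos ht)]
  exact abs_lt_disc ht

/-! ## §4 A rational instance -/

/-- Instance `εo = s = 0`, `εi = 1`, `t = 1`: `δ = 1`, `D = 3`, `α_+ = 2`, `α_− = −1`, levels `2` and
`−1`, inner weights `2/3` and `1/3` — checked directly on the `3 × 3` matrix.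
[cite: SakakibaraEtAl2024, §III] -/
theorem instance_check :
    trilayerScalar 0 1 1 0 *ᵥ ![1, 1, 2] = (2:ℝ) • ![1, 1, 2] ∧
      trilayerScalar 0 1 1 0 *ᵥ ![1, 1, -1] = (-1:ℝ) • ![1, 1, -1] ∧
        innerWeight 2 = 2 / 3 ∧ innerWeight (-1) = 1 / 3 ∧ disc 1 1 = 3 := by
  refine ⟨?_, ?_, ?_, ?_, ?_⟩
  · rw [trilayerScalar_mulVec_even]
    ext i; fin_cases i <;> norm_num
  · rw [trilayerScalar_mulVec_even]
    ext i; fin_cases i <;> norm_num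
  · rw [innerWeight_def]; norm_num
  · rw [innerWeight_def]; norm_num
  · rw [disc_def, show (1:ℝ) ^ 2 + 8 * 1 ^ 2 = 3 ^ 2 by norm_num, sqrt_sq (by norm_num)]

end TrilayerEven

end Literature.MathematicalPhysics.QuantumLattice

end
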